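import Mathlib
import Summits.Ventures.PercRepro2.Defs
import Summits.Ventures.PercRepro2.Harris
import Summits.Ventures.PercRepro2.Graph
import Summits.Ventures.PercRepro2.Induced
import Summits.Ventures.PercRepro2.VdBKahn
import Summits.Ventures.PercRepro2.NestIID

/-!
# The mixed nested core-forbidden inequality (Theorem 3 of proofs/MINE1-SAMEKERNEL-FRAME.md §9)
(blind cell PercRepro2, mine-1 g11)

Two independent Bernoulli(`p`) clusters `C, C'` of a root `s`, copy 1 avoiding `X`, copy 2 avoiding
`Y ⊇ X`, and a vertex `u ∉ Y` forbidden from the core `C ∩ C'`. Since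
`1 − 1[u∈C] 1[u∈C'] = (1 − 1[u∈C]) + (1 − 1[u∈C']) − (1 − 1[u∈C])(1 − 1[u∈C'])`, the statement
"the side signs `σ_x σ_y` are positively correlated under this kernel" is the THREE-NEST inequality

`nestIID (X ∪ u) (Y ∪ u) ≤ nestIID (X ∪ u) Y + nestIID X (Y ∪ u)`

(`nestIID_insert_le_add`): the two one-sided avoidances of `u` dominate the double one. The first
summand has INCOMPARABLE avoided sets (`X ∪ u ⊄ Y`, `Y ⊄ X ∪ u`) and may be negative, so this is not
a consequence of `nestIID_nonneg` alone.

Proof. With the sixteen one-copy masses `A_S = P(S ⊆ C, R_X)`, `A'_S = P(S ⊆ C, R_{X∪u})`,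
`B_S = P(S ⊆ C, R_Y)`, `B'_S = P(S ⊆ C, R_{Y∪u})` (`S ⊆ {x, y}`), the target `Φ` (the difference of
the two sides) satisfies the polynomial identity

`2 P² P' Q Q'³ · Φ = Σ (nonnegative coefficient) × (products of van den Berg–Kahn atoms)`

(`P = A_∅`, `P' = A'_∅`, `Q = B_∅`, `Q' = B'_∅`; the atoms are the four conditional BHK covariances
at `X, X∪u, Y, Y∪u`, the one-point monotonicities `X ⊆ Y`, `X∪u ⊆ Y∪u`, `X ⊆ Y∪u`, `X ⊆ X∪u`,
`Y ⊆ Y∪u`, and the avoidance-mass atom `P Q' ≥ P' Q` = "`P(u ∈ C | R_X) ≥ P(u ∈ C | R_Y)`", all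
instances of `vdBK`). It is the cleared-denominator form of the certificate of the proofs file:
in the conditional variables `a = P(u∈C | R_X)`, `b = P(u∈C | R_Y)`, the laws `α, ᾱ, β, β̄` given
`u ∈ C` / `u ∉ C`, `T := Φ/(A_∅ B_∅) = (1−b)Cov_A + (1−a)Cov_B + (1−a)b Cov_ᾱ + a(1−b)Cov_β̄ + T'`
and `2(1−b)T'` is an explicit nonnegative combination of products of the one-point differences
`e = μ_A − μ_B`, `g = ᾱ − β̄`, `h = μ_A − β̄`, `d_A = α − ᾱ`, `d_B = β − β̄` with coefficients
polynomial in `a, b`, nonnegative for `b ≤ a`. The degenerate cases: `P = 0` or `Q = 0` make `Φ = 0`;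
`P' = 0` makes `Φ = nestIID X (Y∪u) ≥ 0`; `Q' = 0` with `P, P', Q > 0` contradicts `P' Q ≤ P Q'`.
-/

namespace Summit.Ventures.PercRepro2

section MixedNestIID

variable {V : Type*} {E : Type*} [Fintype E] [DecidableEq E] [Fintype V] [DecidableEq V]
  {R : Type*} [CommRing R] [LinearOrder R] [IsStrictOrderedRing R]

variable (p : E → R) (ends : E → Sym2 V) (s : V)

omit [Fintype E] [DecidableEq E] [Fintype V] [DecidableEq V] in
/-- Avoiding a larger set is the smaller event. -/
lemma avoidAll_anti {X Y : Finset V} (h : X ⊆ Y) : avoidAll ends s Y ⊆ avoidAll ends s X :=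
  fun _ hω v hv => hω v (h hv)

set_option maxHeartbeats 400000 in
/-- **The algebraic core of Theorem 3.** Sixteen "masses" `P, P', Q, Q'` (avoidance masses at
`X, X∪u, Y, Y∪u`) and `A_S, A'_S, B_S, B'_S` (`S ∈ {x, y, xy}`) satisfying the van den Berg–Kahn
atoms (conditional positive association at each avoided set; monotonicity of the one-point masses
along `X ⊆ Y`, `X∪u ⊆ Y∪u`, `X ⊆ Y∪u`, `X ⊆ X∪u`, `Y ⊆ Y∪u`; and `P' Q ≤ P Q'`), nonnegativity,
domination by the avoidance masses, and the NEST inequality at `(X, Y∪u)`, satisfy the three-nest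
inequality. The certificate is the polynomial identity `key`. -/
lemma mixedNest_of_masses {P P' Q Q' Ax Ay Axy Ax' Ay' Axy' Bx By Bxy Bx' By' Bxy' : R}
    (hCA : Ax * Ay ≤ Axy * P) (hCA' : Ax' * Ay' ≤ Axy' * P') (hCB : Bx * By ≤ Bxy * Q)
    (hCB' : Bx' * By' ≤ Bxy' * Q') (hEx : Bx * P ≤ Ax * Q) (hEy : By * P ≤ Ay * Q)
    (hGx : Bx' * P' ≤ Ax' * Q') (hGy : By' * P' ≤ Ay' * Q') (hHx : Bx' * P ≤ Ax * Q')
    (hHy : By' * P ≤ Ay * Q') (hNAx : Ax' * P ≤ Ax * P') (hNAy : Ay' * P ≤ Ay * P')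
    (hNBx : Bx' * Q ≤ Bx * Q') (hNBy : By' * Q ≤ By * Q') (hM : P' * Q ≤ P * Q')
    (hPn : 0 ≤ P) (hP'n : 0 ≤ P') (hQn : 0 ≤ Q) (hQ'n : 0 ≤ Q')
    (hAxn : 0 ≤ Ax) (hAyn : 0 ≤ Ay) (hAxyn : 0 ≤ Axy) (hAx'n : 0 ≤ Ax') (hAy'n : 0 ≤ Ay')
    (hAxy'n : 0 ≤ Axy') (hBxn : 0 ≤ Bx) (hByn : 0 ≤ By) (hBxyn : 0 ≤ Bxy) (hBx'n : 0 ≤ Bx')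
    (hBy'n : 0 ≤ By') (hBxy'n : 0 ≤ Bxy')
    (hP'P : P' ≤ P) (hQ'Q : Q' ≤ Q) (hAxP : Ax ≤ P) (hAyP : Ay ≤ P) (hAxyP : Axy ≤ P)
    (hAx'P : Ax' ≤ P') (hAy'P : Ay' ≤ P') (hAxy'P : Axy' ≤ P') (hBxQ : Bx ≤ Q) (hByQ : By ≤ Q)
    (hBxyQ : Bxy ≤ Q) (hBx'Q : Bx' ≤ Q') (hBy'Q : By' ≤ Q') (hBxy'Q : Bxy' ≤ Q')
    (hN : 0 ≤ Axy * Q' + P * Bxy' - Ax * By' - Ay * Bx') :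
    Axy' * Q' + P' * Bxy' - Ax' * By' - Ay' * Bx' ≤
      (Axy' * Q + P' * Bxy - Ax' * By - Ay' * Bx) + (Axy * Q' + P * Bxy' - Ax * By' - Ay * Bx') := by
  -- the target
  set Φ := (Axy' * Q + P' * Bxy - Ax' * By - Ay' * Bx) +
    (Axy * Q' + P * Bxy' - Ax * By' - Ay * Bx') -
    (Axy' * Q' + P' * Bxy' - Ax' * By' - Ay' * Bx') with hΦ
  suffices hΦn : 0 ≤ Φ by rw [hΦ] at hΦn; linarith
  -- the atoms as nonnegative quantities
  obtain ⟨cA, hcA, hcA0⟩ : ∃ t, t = Axy * P - Ax * Ay ∧ 0 ≤ t := ⟨_, rfl, by linarith⟩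
  obtain ⟨cA', hcA', hcA'0⟩ : ∃ t, t = Axy' * P' - Ax' * Ay' ∧ 0 ≤ t := ⟨_, rfl, by linarith⟩
  obtain ⟨cB, hcB, hcB0⟩ : ∃ t, t = Bxy * Q - Bx * By ∧ 0 ≤ t := ⟨_, rfl, by linarith⟩
  obtain ⟨cB', hcB', hcB'0⟩ : ∃ t, t = Bxy' * Q' - Bx' * By' ∧ 0 ≤ t := ⟨_, rfl, by linarith⟩
  obtain ⟨ex, hex, hex0⟩ : ∃ t, t = Ax * Q - Bx * P ∧ 0 ≤ t := ⟨_, rfl, by linarith⟩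
  obtain ⟨ey, hey, hey0⟩ : ∃ t, t = Ay * Q - By * P ∧ 0 ≤ t := ⟨_, rfl, by linarith⟩
  obtain ⟨gx, hgx, hgx0⟩ : ∃ t, t = Ax' * Q' - Bx' * P' ∧ 0 ≤ t := ⟨_, rfl, by linarith⟩
  obtain ⟨gy, hgy, hgy0⟩ : ∃ t, t = Ay' * Q' - By' * P' ∧ 0 ≤ t := ⟨_, rfl, by linarith⟩
  obtain ⟨hx, hhx, hhx0⟩ : ∃ t, t = Ax * Q' - Bx' * P ∧ 0 ≤ t := ⟨_, rfl, by linarith⟩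
  obtain ⟨hy, hhy, hhy0⟩ : ∃ t, t = Ay * Q' - By' * P ∧ 0 ≤ t := ⟨_, rfl, by linarith⟩
  obtain ⟨nax, hnax, hnax0⟩ : ∃ t, t = Ax * P' - Ax' * P ∧ 0 ≤ t := ⟨_, rfl, by linarith⟩
  obtain ⟨nay, hnay, hnay0⟩ : ∃ t, t = Ay * P' - Ay' * P ∧ 0 ≤ t := ⟨_, rfl, by linarith⟩
  obtain ⟨nbx, hnbx, hnbx0⟩ : ∃ t, t = Bx * Q' - Bx' * Q ∧ 0 ≤ t := ⟨_, rfl, by linarith⟩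
  obtain ⟨nby, hnby, hnby0⟩ : ∃ t, t = By * Q' - By' * Q ∧ 0 ≤ t := ⟨_, rfl, by linarith⟩
  obtain ⟨m, hm, hm0⟩ : ∃ t, t = P * Q' - P' * Q ∧ 0 ≤ t := ⟨_, rfl, by linarith⟩
  obtain ⟨dP, hdP, hdP0⟩ : ∃ t, t = P - P' ∧ 0 ≤ t := ⟨_, rfl, by linarith⟩
  obtain ⟨dQ, hdQ, hdQ0⟩ : ∃ t, t = Q - Q' ∧ 0 ≤ t := ⟨_, rfl, by linarith⟩
  -- the certificate: `2 P² P' Q Q'³ Φ` is a nonnegative combination of atom products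
  have key : 2 * P ^ 2 * P' * Q * Q' ^ 3 * Φ =
      2 * P * P' * Q * Q' ^ 4 * cA + 2 * P ^ 2 * P' ^ 2 * Q' ^ 3 * cB +
        2 * P ^ 2 * Q * Q' ^ 3 * dQ * cA' + 2 * P ^ 2 * P' * Q * Q' ^ 2 * dP * cB' +
        2 * P' ^ 2 * Q' ^ 3 * ex * ey + P' * Q * Q' * m * (ex * gy + gx * ey) +
        2 * P ^ 2 * Q * Q' * dQ * gx * gy + P' ^ 2 * Q * m * (hx * nby + nbx * hy) +
        Q * Q' ^ 2 * m * (hx * nay + nax * hy) +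
        P' * Q * Q' * (P' * Q + P * Q') * (nax * nby + nbx * nay) +
        Q * m ^ 2 * (hx * gy + gx * hy) := by
    rw [hΦ, hcA, hcA', hcB, hcB', hex, hey, hgx, hgy, hhx, hhy, hnax, hnay, hnbx, hnby, hm, hdP,
      hdQ]
    ring
  have hprod : 0 ≤ 2 * P ^ 2 * P' * Q * Q' ^ 3 * Φ := by
    rw [key]; positivity
  -- conclusion, with the degenerate cases
  rcases hPn.lt_or_eq with hPpos | hP0
  · rcases hQn.lt_or_eq with hQpos | hQ0
    · rcases hP'n.lt_or_eq with hP'pos | hP'0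
      · rcases hQ'n.lt_or_eq with hQ'pos | hQ'0
        · -- main case: divide by the positive multiplier
          have hc : 0 < 2 * P ^ 2 * P' * Q * Q' ^ 3 := by positivity
          by_contra hneg
          have hneg' : Φ < 0 := not_le.1 hneg
          have := mul_neg_of_pos_of_neg hc hneg'
          linarith
        · -- `Q' = 0` contradicts `P' Q ≤ P Q'` with `P', Q > 0`
          exfalso
          have h1 : 0 < P' * Q := mul_pos hP'pos hQpos
          rw [← hQ'0, mul_zero] at hM
          linarith
      · -- `P' = 0`: the `X ∪ u` masses vanish and `Φ = nestIID X (Y ∪ u) ≥ 0`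
        have e1 : Ax' = 0 := le_antisymm (hP'0 ▸ hAx'P) hAx'n
        have e2 : Ay' = 0 := le_antisymm (hP'0 ▸ hAy'P) hAy'n
        have e3 : Axy' = 0 := le_antisymm (hP'0 ▸ hAxy'P) hAxy'n
        have : Φ = Axy * Q' + P * Bxy' - Ax * By' - Ay * Bx' := by
          rw [hΦ, ← hP'0, e1, e2, e3]; ring
        rw [this]; exact hN
    · -- `Q = 0`: every `Y`-side mass vanishes and `Φ = 0`
      have e1 : Bx = 0 := le_antisymm (hQ0 ▸ hBxQ) hBxn
      have e2 : By = 0 := le_antisymm (hQ0 ▸ hByQ) hByn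
      have e3 : Bxy = 0 := le_antisymm (hQ0 ▸ hBxyQ) hBxyn
      have hQ'0 : Q' = 0 := le_antisymm (hQ0 ▸ hQ'Q) hQ'n
      have e4 : Bx' = 0 := le_antisymm (hQ'0 ▸ hBx'Q) hBx'n
      have e5 : By' = 0 := le_antisymm (hQ'0 ▸ hBy'Q) hBy'n
      have e6 : Bxy' = 0 := le_antisymm (hQ'0 ▸ hBxy'Q) hBxy'n
      have : Φ = 0 := by rw [hΦ, ← hQ0, hQ'0, e1, e2, e3, e4, e5, e6]; ring
      rw [this]
  · -- `P = 0`: every `X`-side mass vanishes and `Φ = 0`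
    have e1 : Ax = 0 := le_antisymm (hP0 ▸ hAxP) hAxn
    have e2 : Ay = 0 := le_antisymm (hP0 ▸ hAyP) hAyn
    have e3 : Axy = 0 := le_antisymm (hP0 ▸ hAxyP) hAxyn
    have hP'0 : P' = 0 := le_antisymm (hP0 ▸ hP'P) hP'n
    have e4 : Ax' = 0 := le_antisymm (hP'0 ▸ hAx'P) hAx'n
    have e5 : Ay' = 0 := le_antisymm (hP'0 ▸ hAy'P) hAy'n
    have e6 : Axy' = 0 := le_antisymm (hP'0 ▸ hAxy'P) hAxy'n
    have : Φ = 0 := by rw [hΦ, ← hP0, hP'0, e1, e2, e3, e4, e5, e6]; ring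
    rw [this]


/-- **The mixed nested core-forbidden inequality** (Theorem 3, three-nest form): for `X ⊆ Y` and
`u ∉ Y`, `nestIID (X ∪ u) (Y ∪ u) ≤ nestIID (X ∪ u) Y + nestIID X (Y ∪ u)` — equivalently the
two-copy sum `Σ w w' 1_{R_X}(ω) 1_{R_Y}(ω') (1 − 1[u∈C] 1[u∈C']) σ_x σ_y` is nonnegative. -/
theorem nestIID_insert_le_add (hp : IsProbVec p) (x y : V) {X Y : Finset V} (u : V) (hXY : X ⊆ Y)
    (huY : u ∉ Y) :
    nestIID p ends s x y (insert u X) (insert u Y) ≤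
      nestIID p ends s x y (insert u X) Y + nestIID p ends s x y X (insert u Y) := by
  classical
  -- Finset bookkeeping
  have hXuY : X ⊆ insert u Y := hXY.trans (Finset.subset_insert u Y)
  have hXuX : X ⊆ insert u X := Finset.subset_insert u X
  have hYuY : Y ⊆ insert u Y := Finset.subset_insert u Y
  have huXY : insert u X ⊆ insert u Y := Finset.insert_subset_insert u hXY
  have hYX : Y ∩ X = X := Finset.inter_eq_right.2 hXY
  have hYX' : Y ∪ X = Y := Finset.union_eq_left.2 hXY
  have hYuX : insert u Y ∩ X = X := Finset.inter_eq_right.2 hXuY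
  have hYuX' : insert u Y ∪ X = insert u Y := Finset.union_eq_left.2 hXuY
  have hXuXi : insert u X ∩ X = X := Finset.inter_eq_right.2 hXuX
  have hXuXu : insert u X ∪ X = insert u X := Finset.union_eq_left.2 hXuX
  have hYuYi : insert u Y ∩ Y = Y := Finset.inter_eq_right.2 hYuY
  have hYuYu : insert u Y ∪ Y = insert u Y := Finset.union_eq_left.2 hYuY
  have hYuXu : insert u Y ∩ insert u X = insert u X := Finset.inter_eq_right.2 huXY
  have hYuXu' : insert u Y ∪ insert u X = insert u Y := Finset.union_eq_left.2 huXY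
  have hXuYi : insert u X ∩ Y = X := by
    rw [Finset.insert_inter_of_notMem huY]; exact Finset.inter_eq_left.2 hXY
  have hXuYu : insert u X ∪ Y = insert u Y := by
    rw [Finset.insert_union, Finset.union_eq_right.2 hXY]
  -- the `P' = 0` fallback, in mass form
  have hN := nestIID_nonneg p ends s hp x y hXuY
  rw [nestIID_eq p ends s x y X (insert u Y)] at hN
  rw [nestIID_eq p ends s x y (insert u X) (insert u Y), nestIID_eq p ends s x y (insert u X) Y,
    nestIID_eq p ends s x y X (insert u Y)]
  -- the van den Berg–Kahn atoms
  have hCA := vdBK p hp ends s {x} {y} X X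
  have hCA' := vdBK p hp ends s {x} {y} (insert u X) (insert u X)
  have hCB := vdBK p hp ends s {x} {y} Y Y
  have hCB' := vdBK p hp ends s {x} {y} (insert u Y) (insert u Y)
  simp only [Finset.inter_self, Finset.union_self] at hCA hCA' hCB hCB'
  have hEx := vdBK p hp ends s {x} ∅ Y X
  have hEy := vdBK p hp ends s {y} ∅ Y X
  simp only [connAll_empty, Set.univ_inter, Finset.union_empty, hYX, hYX'] at hEx hEy
  have hGx := vdBK p hp ends s {x} ∅ (insert u Y) (insert u X)
  have hGy := vdBK p hp ends s {y} ∅ (insert u Y) (insert u X)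
  simp only [connAll_empty, Set.univ_inter, Finset.union_empty, hYuXu, hYuXu'] at hGx hGy
  have hHx := vdBK p hp ends s {x} ∅ (insert u Y) X
  have hHy := vdBK p hp ends s {y} ∅ (insert u Y) X
  simp only [connAll_empty, Set.univ_inter, Finset.union_empty, hYuX, hYuX'] at hHx hHy
  have hNAx := vdBK p hp ends s {x} ∅ (insert u X) X
  have hNAy := vdBK p hp ends s {y} ∅ (insert u X) X
  simp only [connAll_empty, Set.univ_inter, Finset.union_empty, hXuXi, hXuXu] at hNAx hNAy
  have hNBx := vdBK p hp ends s {x} ∅ (insert u Y) Y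
  have hNBy := vdBK p hp ends s {y} ∅ (insert u Y) Y
  simp only [connAll_empty, Set.univ_inter, Finset.union_empty, hYuYi, hYuYu] at hNBx hNBy
  have hM := vdBK p hp ends s ∅ ∅ (insert u X) Y
  simp only [connAll_empty, Set.univ_inter, Finset.union_empty, hXuYi, hXuYu] at hM
  exact mixedNest_of_masses hCA hCA' hCB hCB' hEx hEy hGx hGy hHx hHy hNAx hNAy hNBx hNBy hM
    (prob_nonneg hp _) (prob_nonneg hp _) (prob_nonneg hp _) (prob_nonneg hp _)
    (prob_nonneg hp _) (prob_nonneg hp _) (prob_nonneg hp _) (prob_nonneg hp _)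
    (prob_nonneg hp _) (prob_nonneg hp _) (prob_nonneg hp _) (prob_nonneg hp _)
    (prob_nonneg hp _) (prob_nonneg hp _) (prob_nonneg hp _) (prob_nonneg hp _)
    (prob_mono hp (avoidAll_anti ends s hXuX)) (prob_mono hp (avoidAll_anti ends s hYuY))
    (prob_mono hp Set.inter_subset_right) (prob_mono hp Set.inter_subset_right)
    (prob_mono hp Set.inter_subset_right) (prob_mono hp Set.inter_subset_right)
    (prob_mono hp Set.inter_subset_right) (prob_mono hp Set.inter_subset_right)
    (prob_mono hp Set.inter_subset_right) (prob_mono hp Set.inter_subset_right)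
    (prob_mono hp Set.inter_subset_right) (prob_mono hp Set.inter_subset_right)
    (prob_mono hp Set.inter_subset_right) (prob_mono hp Set.inter_subset_right) hN

end MixedNestIID

end Summit.Ventures.PercRepro2
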